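import Literature.Computability.AlgebraicComplexity.OneSliceSpeedup
import Mathlib.LinearAlgebra.Matrix.Rank
import Mathlib.LinearAlgebra.Basis.VectorSpace
import HarnessLib

/-!
# Compression of a direct sum of one-slice tensors (Alman–Li 2026, Prop. 5.7)

Topic `Literature/Computability/AlgebraicComplexity` (family `MatrixMultiplication`). Source: J. Alman,
B. Li, *Asymptotic Rank Speedup Theorems, Revisited*, arXiv:2605.21738 (2026), §5.4, Proposition 5.7
with its printed proof (held text `paper:arxiv-2605.21738`, p0014 L63–93).

## The printed statement (p0014)

"**Proposition 5.7.** Let `T = ⊕_{i=1}^k ⟨1,n_i,1⟩` be a direct sum of one-slice matrix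
multiplication tensors, and let `A ⊆ U^∨` be a subspace of codimension `p`. Then there exists a
tensor `T' ≤ (A ⊗ id_V ⊗ id_W) T` that is still a direct sum of one-slice matrix multiplication
tensors: `T' ≅ ⊕_{i=1}^k ⟨1, n_i − p_i, 1⟩`, where the integers `p_i` satisfy `0 ≤ p_i ≤ n_i` and
`∑_{i=1}^k p_i = p`."

Printed proof: "Let `(x^{(i)}_j)`, `(y^{(i)}_j)` denote the bases of the `U`- and `V`-modes of `T`
corresponding to the decomposition. Identify `A` with a surjective linear map `A : U → U'` where
`dim U' = dim U − p`. Consider the set of vectors `{A(x^{(i)}_j)} ⊆ U'`. Choose a subset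
`D ⊆ {x^{(i)}_j}` of size `dim U'` such that `{A(x) : x ∈ D}` is linearly independent (hence a basis
of `U'`). Now restrict `T` by zeroing out every basis element `x^{(i)}_j` (and the corresponding
`y^{(i)}_j`) with `x^{(i)}_j ∉ D`. This reduces the `i`th summand `⟨1,n_i,1⟩` to `⟨1,n_i−p_i,1⟩`,
where `p_i` is the number of removed basis elements from the `i`th block. By construction,
`∑_i p_i = p`. Finally, the restriction of `A` to `Span D` is an isomorphism onto `U'`, so after
the above zeroing-out operation the resulting tensor is indeed a restriction of `(A ⊗ id_V ⊗ id_W) T`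
and has the claimed direct-sum form."

## The form proved here (coordinates)

`K` a field; the summands are indexed by `i : Fin k` with sizes `n i`; the `U`- and `V`-modes of
`T = ⊕_i ⟨1,n_i,1⟩` are indexed by `Σ i, Fin (n i)` (basis vectors `x^{(i)}_j = ⟨i, j⟩`) and the
`W`-mode by `Fin k` (one slice per summand), so `T x y l = [x = y ∧ x.1 = l]`.  The surjection
`A : U → U'` is a matrix `A : ι' → (Σ i, Fin (n i)) → K` of full row rank `|ι'|` with
`|ι'| + p = ∑ n_i` (codimension `p`), and `(A ⊗ id ⊗ id) T` is the tensor
`(a', y, l) ↦ ∑_x A a' x · T x y l` on `ι' × (Σ i, Fin (n i)) × Fin k`.  `AlmanLi2026.prop57` gives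
integers `q i ≤ n i` with `∑ q_i = p` and the restriction
`(A ⊗ id ⊗ id) T ≥ ⊕_i ⟨1, n_i − q_i, 1⟩` (the latter on `Σ i, Fin (n i − q i)`), with the printed
proof: a column basis `D` (`LinearIndepOn.extend`), `q_i = n_i − |D ∩ block i|`, the zeroing-out
map on the `V`-mode, and on the `U'`-mode the coordinate functionals of the basis `{A(x) : x ∈ D}`
(the inverse of `A|_{Span D}`).  No new definitions, no named facts.

## References

* J. Alman, B. Li, *Asymptotic Rank Speedup Theorems, Revisited*, arXiv:2605.21738 (2026), Prop. 5.7
  and its proof (p0014). [AlmanLi2026]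
-/

noncomputable section

open scoped BigOperators

namespace Literature.Computability.AlgebraicComplexity

universe u

variable {K : Type u} [Field K]

namespace AlmanLi2026

/-- **Alman–Li 2026, Prop. 5.7 (compression of a direct sum of one-slice tensors)**, in
coordinates over a field: for `T = ⊕_{i<k} ⟨1,n_i,1⟩` (`T x y l = [x = y ∧ x.1 = l]` on
`(Σ i, Fin (n i))² × Fin k`) and a full-row-rank `A : ι' → (Σ i, Fin (n i)) → K` with
`|ι'| + p = ∑_i n_i` (a surjection `U → U'` of codimension `p`, i.e. a codimension-`p` subspace of
`U^∨`), there are `q_i ≤ n_i` with `∑_i q_i = p` and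
`(A ⊗ id ⊗ id) T ≥ ⊕_{i<k} ⟨1, n_i − q_i, 1⟩`. [cite: AlmanLi2026, Prop. 5.7] -/
theorem prop57 {k : ℕ} (n : Fin k → ℕ) {ι' : Type*} [Fintype ι'] [DecidableEq ι']
    (A : ι' → (Σ i : Fin k, Fin (n i)) → K) {p : ℕ}
    (hrank : (Matrix.of A).rank = Fintype.card ι') (hp : Fintype.card ι' + p = ∑ i, n i) :
    ∃ q : Fin k → ℕ, (∀ i, q i ≤ n i) ∧ ∑ i, q i = p ∧
      TensorRestrictsTo
        (fun (a' : ι') (y : Σ i : Fin k, Fin (n i)) (l : Fin k) =>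
          ∑ x : (Σ i : Fin k, Fin (n i)), A a' x * (if x = y ∧ x.1 = l then (1 : K) else 0))
        (fun (x y : Σ i : Fin k, Fin (n i - q i)) (l : Fin k) =>
          if x = y ∧ x.1 = l then (1 : K) else 0) := by
  classical
  -- the columns `A(x^{(i)}_j)` of `A`
  let c : (Σ i : Fin k, Fin (n i)) → (ι' → K) := fun x a' => A a' x
  -- "Choose a subset D … such that {A(x) : x ∈ D} is linearly independent (hence a basis of U')"
  have h0 : LinearIndepOn K c ∅ := linearIndepOn_empty K c
  obtain ⟨D, hDli, hDspan⟩ : ∃ D : Set (Σ i : Fin k, Fin (n i)), LinearIndepOn K c D ∧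
      Submodule.span K (c '' D) = Submodule.span K (Set.range c) :=
    ⟨h0.extend (Set.empty_subset Set.univ), h0.linearIndepOn_extend _, by
      rw [h0.span_image_extend_eq_span_image, Set.image_univ]⟩
  have hspan_top : Submodule.span K (Set.range c) = ⊤ := by
    apply Submodule.eq_top_of_finrank_eq
    rw [Module.finrank_fintype_fun_eq_card, ← hrank, Matrix.rank_eq_finrank_span_cols]
    rfl
  have hliD : LinearIndependent K (fun d : D => c d) := hDli
  have hspD : ⊤ ≤ Submodule.span K (Set.range (fun d : D => c d)) := by
    rw [← Set.image_eq_range, hDspan, hspan_top]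
  let B : Module.Basis D K (ι' → K) := Module.Basis.mk hliD hspD
  have hB : ∀ d : D, B d = c d := fun d => Module.Basis.mk_apply hliD hspD d
  -- `|D| = dim U' = |ι'|`
  have hcardD : Fintype.card D = Fintype.card ι' :=
    (Module.finrank_eq_card_basis B).symm.trans (Module.finrank_fintype_fun_eq_card K)
  -- the blocks `D ∩ block i` and the integers `q i = n i − |D ∩ block i|`
  let Dfib : Fin k → Type _ := fun i => {j : Fin (n i) // (⟨i, j⟩ : Σ i : Fin k, Fin (n i)) ∈ D}
  let q : Fin k → ℕ := fun i => n i - Fintype.card (Dfib i)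
  have hqle : ∀ i, Fintype.card (Dfib i) ≤ n i := fun i =>
    (Fintype.card_subtype_le _).trans (Fintype.card_fin _).le
  have hnq : ∀ i, n i - q i = Fintype.card (Dfib i) := fun i => Nat.sub_sub_self (hqle i)
  let eD : (Σ i, Dfib i) ≃ D :=
    { toFun := fun z => ⟨⟨z.1, z.2.1⟩, z.2.2⟩
      invFun := fun d => ⟨d.1.1, ⟨d.1.2, d.2⟩⟩
      left_inv := fun _ => rfl
      right_inv := fun _ => rfl }
  have hsum : ∑ i, Fintype.card (Dfib i) = Fintype.card D := by
    rw [← Fintype.card_sigma]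
    exact Fintype.card_congr eD
  have hsumq : ∑ i, q i = p := by
    have h1 : ∑ i, q i = ∑ i, n i - ∑ i, Fintype.card (Dfib i) :=
      Finset.sum_tsub_distrib _ (fun i _ => hqle i)
    have h2 : ∑ i, Fintype.card (Dfib i) ≤ ∑ i, n i := Finset.sum_le_sum fun i _ => hqle i
    rw [h1, hsum, hcardD]
    omega
  -- "zeroing out every basis element … with x^{(i)}_j ∉ D": the surviving indices
  let e : (i : Fin k) → Fin (n i - q i) ≃ Dfib i := fun i =>
    (Fintype.equivFinOfCardEq (hnq i).symm).symm
  let ε : (Σ i : Fin k, Fin (n i - q i)) → (Σ i : Fin k, Fin (n i)) :=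
    fun y => ⟨y.1, (e y.1 y.2).1⟩
  have hε1 : ∀ y, (ε y).1 = y.1 := fun _ => rfl
  have hεmem : ∀ y, ε y ∈ D := fun y => (e y.1 y.2).2
  have hεinj : Function.Injective ε := by
    rintro ⟨i, j⟩ ⟨i', j'⟩ h
    simp only [ε, Sigma.mk.injEq] at h
    obtain ⟨rfl, h2⟩ := h
    have h3 : e i j = e i j' := Subtype.ext (eq_of_heq h2)
    rw [(e i).injective h3]
  refine ⟨q, fun i => Nat.sub_le _ _, hsumq, ?_⟩
  -- the restriction: coordinate functionals of the basis `B` on `U'`, selection of `D` on `V`,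
  -- identity on `W`
  refine ⟨fun y a' => B.coord ⟨ε y, hεmem y⟩ (Pi.single a' 1),
    fun y x => if x = ε y then 1 else 0, fun l l' => if l' = l then 1 else 0, fun y y' l => ?_⟩
  have inner : ∀ (a₀ : ι') (x₀ : Σ i : Fin k, Fin (n i)) (l₀ : Fin k),
      (∑ x : (Σ i : Fin k, Fin (n i)), A a₀ x * (if x = x₀ ∧ x.1 = l₀ then (1 : K) else 0)) =
        if x₀.1 = l₀ then A a₀ x₀ else 0 := by
    intro a₀ x₀ l₀
    rw [Finset.sum_eq_single x₀ (fun x _ hx => by simp [hx])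
      (fun h => absurd (Finset.mem_univ _) h)]
    by_cases h : x₀.1 = l₀ <;> simp [h]
  simp_rw [inner]
  have step : ∀ a₀ : ι',
      (∑ x₀ : (Σ i : Fin k, Fin (n i)), ∑ l₀ : Fin k,
        B.coord ⟨ε y, hεmem y⟩ (Pi.single a₀ 1) * (if x₀ = ε y' then (1 : K) else 0) *
          (if l₀ = l then (1 : K) else 0) * (if x₀.1 = l₀ then A a₀ x₀ else 0)) =
        if y'.1 = l then B.coord ⟨ε y, hεmem y⟩ (Pi.single a₀ 1) * A a₀ (ε y') else 0 := by
    intro a₀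
    rw [Finset.sum_eq_single (ε y') (fun x₀ _ hx₀ => by simp [hx₀])
      (fun h => absurd (Finset.mem_univ _) h),
      Finset.sum_eq_single l (fun l₀ _ hl₀ => by simp [hl₀])
      (fun h => absurd (Finset.mem_univ _) h)]
    rw [hε1]
    by_cases h : y'.1 = l <;> simp [h]
  simp_rw [step]
  -- `∑_{a'} B.coord_d (e_{a'}) · A a' (ε y') = B.coord_d (A (ε y')) = [d = ε y']`
  have hcoord : (∑ a₀ : ι', B.coord ⟨ε y, hεmem y⟩ (Pi.single a₀ 1) * A a₀ (ε y')) =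
      if y = y' then 1 else 0 := by
    have hc : c (ε y') = ∑ a₀ : ι', A a₀ (ε y') • (Pi.single a₀ (1 : K) : ι' → K) := by
      funext a'
      simp [c, Finset.sum_apply, Pi.single_apply]
    have h1 : B.coord ⟨ε y, hεmem y⟩ (c (ε y')) = if y = y' then 1 else 0 := by
      rw [show c (ε y') = B ⟨ε y', hεmem y'⟩ from (hB ⟨ε y', hεmem y'⟩).symm, Module.Basis.coord_apply,
        Module.Basis.repr_self, Finsupp.single_apply]
      simp only [Subtype.mk.injEq, hεinj.eq_iff]
      by_cases h : y = y'
      · subst h; simp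
      · simp [h, Ne.symm h]
    rw [← h1, hc, map_sum]
    refine Finset.sum_congr rfl fun a₀ _ => ?_
    rw [map_smul, smul_eq_mul, mul_comm]
  by_cases hl : y'.1 = l
  · simp only [hl, if_true]
    rw [hcoord]
    by_cases h : y = y'
    · subst h; simp [hl]
    · simp [h]
  · simp only [hl, if_false, Finset.sum_const_zero]
    rw [if_neg]
    rintro ⟨rfl, h⟩
    exact hl h

end AlmanLi2026

end Literature.Computability.AlgebraicComplexity
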